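import Mathlib
import HarnessLib
import Summits.Ventures.LatticeQCDFlow.Scaling.Bhattacharyya
import Summits.Ventures.LatticeQCDFlow.Scaling.AcceptanceTransfer
import Summits.Ventures.LatticeQCDFlow.Scaling.IMHVolumeLaw

/-!
# LatticeQCDFlow / Scaling — the acceptance of a FACTORISED flow is sandwiched:
# `∏ᵢ acc(pᵢ, qᵢ) ≤ acc(⊗pᵢ, ⊗qᵢ) ≤ minᵢ acc(pᵢ, qᵢ)` (and `≤ ∏ᵢ BC(pᵢ, qᵢ)²`), the lower rate
# attained by hit-or-miss blocks

HONEST FRAMING: exact (Metropolis-corrected) sampling algorithms for lattice gauge theory;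
figures of merit are autocorrelation/cost numbers at stated couplings and volumes; no
continuum-physics claim.

Venture `LatticeQCDFlow` (cell pub-lqcd), topic `Scaling`; FANOUT row 3 (`s0-u1-a`, S0-B
implementation A, GEN-11).  NEW WORK of the cell (elementary finite sums), not a published result;
NO definition is introduced.  Vocabulary: `accRate` (row 30's `Exactness/FlowMCMC`), `prodLaw`,
`blockProd`, `essFrac` (row 31's `Scaling/ImportanceWeights`), `bhatt` and the upper volume law
`acc ≤ BC²`, `BC(⊗) = ∏ BC` (row 31's `Scaling/Bhattacharyya`, T2-M/T2-M′, imported),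
`accRate_nonneg` (row 3's `Scaling/AcceptanceTransfer`) and `sum_blockProd_eq_one` (row 31's
`Scaling/IMHVolumeLaw`), both imported.

The tree's volume laws for a flow that FACTORISES over independent blocks (the factorised MODEL
regime of Abbott et al. 2022 §V) are: ESS is exactly multiplicative (`essFrac_blockProd`, T2-B) and
the acceptance is at most `∏ᵢ BC(pᵢ, qᵢ)² ≤ e^{−mδ²}` (T2-M′).  This file supplies the LOWER
companion and the trivial ceiling, so that the acceptance of a product flow is pinned between two
exponentials:

* §1 two blocks: `min_mul_min_le_min_mul` (`min(a,a′)·min(b,b′) ≤ min(ab, a′b′)` for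
  nonnegatives), `accRate_prodLaw_eq` (the four-fold sum), **`mul_accRate_le_accRate_prodLaw`**
  (`acc₁·acc₂ ≤ acc(p₁⊗p₂, q₁⊗q₂)` — acceptance is SUPER-MULTIPLICATIVE), and
  `accRate_prodLaw_le_left/right` (`acc(⊗) ≤ acc₁`, `≤ acc₂`: a block can only cost acceptance;
  only the normalisation of the other block is used);
* §2 `m` blocks: `accRate_comp_equiv` (relabelling invariance), `accRate_blockProd_succ` (peel the
  first block), **`prod_accRate_le_accRate_blockProd`** (`∏ᵢ accᵢ ≤ acc(⊗)`),
  **`accRate_blockProd_le`** (`acc(⊗) ≤ accᵢ` for every block `i`), the identical-block forms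
  `pow_accRate_le_accRate_blockProd_const` / `accRate_blockProd_const_le` (`acc₁^m ≤ acc_m ≤ acc₁`),
  and the two-sided exponential law **`accRate_blockProd_sandwich`**
  (`∏ᵢ accᵢ ≤ acc(⊗) ≤ ∏ᵢ BC(pᵢ, qᵢ)²`): per block, the acceptance of a product flow decays at a
  rate between `log(1/accᵢ)` and `log(1/BCᵢ²)`;
* §3 sharpness of the lower rate: for HIT-OR-MISS blocks (two-point target `δ_hit`, model hitting
  with probability `αᵢ`) `accᵢ = BCᵢ² = αᵢ` (`hitOrMiss_accRate`, `hitOrMiss_bhatt_sq`), so the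
  sandwich collapses: **`accRate_blockProd_hitOrMiss`** `acc(⊗) = ∏ᵢ αᵢ` EXACTLY — the product of
  the block acceptances is attained, at every `m`.  (The ceiling `minᵢ accᵢ` is attained when all
  other blocks are perfect, `pᵢ = qᵢ`.)

Reading (value-free): gluing independently trained block flows never yields a global acceptance
below the product of the block acceptances, and never above the worst block's; against the exact
ESS law `ESS(⊗) = ∏ ESSᵢ` and row 3's `acc ≥ (8/9)·ESS`, note that the global floor
`(8/9)·∏ ESSᵢ` beats the block-wise product `∏ (8/9)ESSᵢ` for `m ≥ 2`.
NOT CLAIMED: anything about non-factorised (coupled) flows; any acceptance of ours; nothing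
re-scored.
-/

namespace Summit.Ventures.LatticeQCDFlow.Theory2

open Finset
open Summit.Ventures.LatticeQCDFlow.Exactness

/-! ## §0 Relabelling invariance -/

section Relabel

variable {X Y : Type*} [Fintype X] [Fintype Y]

/-- **Relabelling invariance**: `acc(p ∘ e, q ∘ e) = acc(p, q)` for any bijection `e : X ≃ Y`.
[folklore] -/
theorem accRate_comp_equiv (e : X ≃ Y) (p q : Y → ℝ) :
    accRate (p ∘ e) (q ∘ e) = accRate p q := by
  unfold accRate
  calc ∑ x, ∑ x', min ((p ∘ e) x * (q ∘ e) x') ((p ∘ e) x' * (q ∘ e) x)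
      = ∑ x, ∑ y', min (p (e x) * q y') (p y' * q (e x)) :=
        sum_congr rfl fun x _ => e.sum_comp (fun y' => min (p (e x) * q y') (p y' * q (e x)))
    _ = ∑ y, ∑ y', min (p y * q y') (p y' * q y) :=
        e.sum_comp (fun y => ∑ y', min (p y * q y') (p y' * q y))

end Relabel

/-! ## §1 Two blocks -/

section TwoBlocks

variable {X Y : Type*} [Fintype X] [Fintype Y]

omit [Fintype X] [Fintype Y] in
/-- `min(a, a′)·min(b, b′) ≤ min(ab, a′b′)` for nonnegative reals. [folklore] -/
theorem min_mul_min_le_min_mul {a a' b b' : ℝ} (ha : 0 ≤ a) (ha' : 0 ≤ a') (hb : 0 ≤ b)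
    (hb' : 0 ≤ b') : min a a' * min b b' ≤ min (a * b) (a' * b') :=
  le_min (mul_le_mul (min_le_left _ _) (min_le_left _ _) (le_min hb hb') ha)
    (mul_le_mul (min_le_right _ _) (min_le_right _ _) (le_min hb hb') ha')

/-- **The acceptance of a two-block product flow as a four-fold sum**:
`acc(p₁⊗p₂, q₁⊗q₂) = Σ_{x,x′} Σ_{y,y′} min(p₁x q₁x′ · p₂y q₂y′, p₁x′ q₁x · p₂y′ q₂y)`. [ours] -/
theorem accRate_prodLaw_eq (p₁ q₁ : X → ℝ) (p₂ q₂ : Y → ℝ) :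
    accRate (prodLaw p₁ p₂) (prodLaw q₁ q₂)
      = ∑ x, ∑ x', ∑ y, ∑ y',
          min (p₁ x * q₁ x' * (p₂ y * q₂ y')) (p₁ x' * q₁ x * (p₂ y' * q₂ y)) := by
  simp only [accRate, prodLaw, Fintype.sum_prod_type]
  refine sum_congr rfl fun x _ => ?_
  rw [sum_comm]
  refine sum_congr rfl fun x' _ => sum_congr rfl fun y _ => sum_congr rfl fun y' _ => ?_
  congr 1 <;> ring

/-- **Acceptance is SUPER-MULTIPLICATIVE over independent blocks**: for nonnegative block laws,
`acc(p₁, q₁)·acc(p₂, q₂) ≤ acc(p₁⊗p₂, q₁⊗q₂)` (termwise `min(a,a′)min(b,b′) ≤ min(ab, a′b′)`).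
[ours] -/
theorem mul_accRate_le_accRate_prodLaw {p₁ q₁ : X → ℝ} {p₂ q₂ : Y → ℝ} (hp₁ : ∀ x, 0 ≤ p₁ x)
    (hq₁ : ∀ x, 0 ≤ q₁ x) (hp₂ : ∀ y, 0 ≤ p₂ y) (hq₂ : ∀ y, 0 ≤ q₂ y) :
    accRate p₁ q₁ * accRate p₂ q₂ ≤ accRate (prodLaw p₁ p₂) (prodLaw q₁ q₂) := by
  rw [accRate_prodLaw_eq]
  unfold accRate
  simp_rw [sum_mul, mul_sum]
  refine sum_le_sum fun x _ => sum_le_sum fun x' _ => sum_le_sum fun y _ =>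
    sum_le_sum fun y' _ => ?_
  exact min_mul_min_le_min_mul (mul_nonneg (hp₁ x) (hq₁ x')) (mul_nonneg (hp₁ x') (hq₁ x))
    (mul_nonneg (hp₂ y) (hq₂ y')) (mul_nonneg (hp₂ y') (hq₂ y))

/-- **A block can only cost acceptance (left)**: `acc(p₁⊗p₂, q₁⊗q₂) ≤ acc(p₁, q₁)` whenever the
second block's target and model are normalised (`Σ_{y,y′} min(aB, a′B′) ≤ min(a Σ B, a′ Σ B′)`).
[ours] -/
theorem accRate_prodLaw_le_left (p₁ q₁ : X → ℝ) {p₂ q₂ : Y → ℝ} (hp₂1 : ∑ y, p₂ y = 1)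
    (hq₂1 : ∑ y, q₂ y = 1) :
    accRate (prodLaw p₁ p₂) (prodLaw q₁ q₂) ≤ accRate p₁ q₁ := by
  rw [accRate_prodLaw_eq]
  unfold accRate
  refine sum_le_sum fun x _ => sum_le_sum fun x' _ => ?_
  have hB : ∑ y, ∑ y', p₂ y * q₂ y' = 1 := by
    rw [← sum_mul_sum, hp₂1, hq₂1, mul_one]
  have hB' : ∑ y, ∑ y', p₂ y' * q₂ y = 1 := by
    rw [sum_comm, ← sum_mul_sum, hp₂1, hq₂1, mul_one]
  refine le_min ?_ ?_
  · calc ∑ y, ∑ y', min (p₁ x * q₁ x' * (p₂ y * q₂ y')) (p₁ x' * q₁ x * (p₂ y' * q₂ y))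
        ≤ ∑ y, ∑ y', p₁ x * q₁ x' * (p₂ y * q₂ y') :=
          sum_le_sum fun y _ => sum_le_sum fun y' _ => min_le_left _ _
      _ = p₁ x * q₁ x' * ∑ y, ∑ y', p₂ y * q₂ y' := by simp_rw [mul_sum]
      _ = p₁ x * q₁ x' := by rw [hB, mul_one]
  · calc ∑ y, ∑ y', min (p₁ x * q₁ x' * (p₂ y * q₂ y')) (p₁ x' * q₁ x * (p₂ y' * q₂ y))
        ≤ ∑ y, ∑ y', p₁ x' * q₁ x * (p₂ y' * q₂ y) :=
          sum_le_sum fun y _ => sum_le_sum fun y' _ => min_le_right _ _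
      _ = p₁ x' * q₁ x * ∑ y, ∑ y', p₂ y' * q₂ y := by simp_rw [mul_sum]
      _ = p₁ x' * q₁ x := by rw [hB', mul_one]

/-- `acc(p₁⊗p₂, q₁⊗q₂) = acc(p₂⊗p₁, q₂⊗q₁)`: swapping the two blocks (relabelling by
`Equiv.prodComm`). [ours] -/
theorem accRate_prodLaw_swap (p₁ q₁ : X → ℝ) (p₂ q₂ : Y → ℝ) :
    accRate (prodLaw p₁ p₂) (prodLaw q₁ q₂) = accRate (prodLaw p₂ p₁) (prodLaw q₂ q₁) := by
  have e1 : prodLaw p₁ p₂ = prodLaw p₂ p₁ ∘ Equiv.prodComm X Y := by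
    funext z
    simp [prodLaw, mul_comm]
  have e2 : prodLaw q₁ q₂ = prodLaw q₂ q₁ ∘ Equiv.prodComm X Y := by
    funext z
    simp [prodLaw, mul_comm]
  rw [e1, e2, accRate_comp_equiv]

/-- **A block can only cost acceptance (right)**: `acc(p₁⊗p₂, q₁⊗q₂) ≤ acc(p₂, q₂)` whenever the
first block's target and model are normalised. [ours] -/
theorem accRate_prodLaw_le_right {p₁ q₁ : X → ℝ} (hp₁1 : ∑ x, p₁ x = 1) (hq₁1 : ∑ x, q₁ x = 1)
    (p₂ q₂ : Y → ℝ) :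
    accRate (prodLaw p₁ p₂) (prodLaw q₁ q₂) ≤ accRate p₂ q₂ := by
  rw [accRate_prodLaw_swap]
  exact accRate_prodLaw_le_left p₂ q₂ hp₁1 hq₁1

/-- **Two-block sandwich**: `acc₁·acc₂ ≤ acc(p₁⊗p₂, q₁⊗q₂) ≤ min(acc₁, acc₂)` for nonnegative
normalised block laws. [ours] -/
theorem accRate_prodLaw_mem_Icc {p₁ q₁ : X → ℝ} {p₂ q₂ : Y → ℝ} (hp₁ : ∀ x, 0 ≤ p₁ x)
    (hq₁ : ∀ x, 0 ≤ q₁ x) (hp₂ : ∀ y, 0 ≤ p₂ y) (hq₂ : ∀ y, 0 ≤ q₂ y) (hp₁1 : ∑ x, p₁ x = 1)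
    (hq₁1 : ∑ x, q₁ x = 1) (hp₂1 : ∑ y, p₂ y = 1) (hq₂1 : ∑ y, q₂ y = 1) :
    accRate p₁ q₁ * accRate p₂ q₂ ≤ accRate (prodLaw p₁ p₂) (prodLaw q₁ q₂) ∧
    accRate (prodLaw p₁ p₂) (prodLaw q₁ q₂) ≤ min (accRate p₁ q₁) (accRate p₂ q₂) :=
  ⟨mul_accRate_le_accRate_prodLaw hp₁ hq₁ hp₂ hq₂,
    le_min (accRate_prodLaw_le_left p₁ q₁ hp₂1 hq₂1) (accRate_prodLaw_le_right hp₁1 hq₁1 p₂ q₂)⟩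

end TwoBlocks


/-! ## §2 `m` independent blocks -/

section Blocks

variable {Z : Type*} [Fintype Z] {m : ℕ}

omit [Fintype Z] in
/-- Peeling the first block: `blockProd qb (Fin.cons z φ) = qb 0 z · blockProd (Fin.tail qb) φ`.
[ours] -/
theorem blockProd_cons (qb : Fin (m + 1) → Z → ℝ) (z : Z) (φ : Fin m → Z) :
    blockProd qb (Fin.cons z φ) = qb 0 z * blockProd (Fin.tail qb) φ := by
  unfold blockProd
  rw [Fin.prod_univ_succ]
  simp only [Fin.cons_zero, Fin.cons_succ, Fin.tail]

omit [Fintype Z] in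
/-- The `(m+1)`-block product law is the two-block product of block `0` with the `m`-block product
of the tail, up to the relabelling `Fin.consEquiv : Z × (Fin m → Z) ≃ (Fin (m+1) → Z)`. [ours] -/
theorem blockProd_comp_consEquiv (qb : Fin (m + 1) → Z → ℝ) :
    blockProd qb ∘ Fin.consEquiv (fun _ : Fin (m + 1) => Z)
      = prodLaw (qb 0) (blockProd (Fin.tail qb)) := by
  funext zφ
  obtain ⟨z, φ⟩ := zφ
  simp only [Function.comp_apply, prodLaw]
  exact blockProd_cons qb z φ

/-- **Peel the first block**:
`acc(⊗_{i<m+1}) = acc(p₀ ⊗ (⊗_{i≥1} pᵢ), q₀ ⊗ (⊗_{i≥1} qᵢ))`. [ours] -/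
theorem accRate_blockProd_succ (pb qb : Fin (m + 1) → Z → ℝ) :
    accRate (blockProd pb) (blockProd qb)
      = accRate (prodLaw (pb 0) (blockProd (Fin.tail pb)))
          (prodLaw (qb 0) (blockProd (Fin.tail qb))) := by
  rw [← accRate_comp_equiv (Fin.consEquiv fun _ : Fin (m + 1) => Z) (blockProd pb) (blockProd qb),
    blockProd_comp_consEquiv, blockProd_comp_consEquiv]

/-- The acceptance of the EMPTY product (one-point space, unit masses) is `1`. [ours] -/
theorem accRate_blockProd_zero (pb qb : Fin 0 → Z → ℝ) :
    accRate (blockProd pb) (blockProd qb) = 1 := by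
  simp [accRate, blockProd]

/-- **`∏ᵢ acc(pᵢ, qᵢ) ≤ acc(⊗pᵢ, ⊗qᵢ)`**: the acceptance of a factorised flow is at least the
product of its block acceptances (nonnegative block laws). [ours] -/
theorem prod_accRate_le_accRate_blockProd {pb qb : Fin m → Z → ℝ} (hp : ∀ i z, 0 ≤ pb i z)
    (hq : ∀ i z, 0 ≤ qb i z) :
    ∏ i, accRate (pb i) (qb i) ≤ accRate (blockProd pb) (blockProd qb) := by
  induction m with
  | zero => rw [accRate_blockProd_zero]; simp
  | succ m ih =>
    rw [Fin.prod_univ_succ, accRate_blockProd_succ]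
    have hP : ∀ φ, 0 ≤ blockProd (Fin.tail pb) φ := fun φ => prod_nonneg fun i _ => hp _ _
    have hQ : ∀ φ, 0 ≤ blockProd (Fin.tail qb) φ := fun φ => prod_nonneg fun i _ => hq _ _
    calc accRate (pb 0) (qb 0) * ∏ i : Fin m, accRate (pb i.succ) (qb i.succ)
        ≤ accRate (pb 0) (qb 0) * accRate (blockProd (Fin.tail pb)) (blockProd (Fin.tail qb)) :=
          mul_le_mul_of_nonneg_left (ih (fun i z => hp _ _) (fun i z => hq _ _))
            (accRate_nonneg (hp 0) (hq 0))
      _ ≤ _ := mul_accRate_le_accRate_prodLaw (hp 0) (hq 0) hP hQ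

/-- **`acc(⊗pᵢ, ⊗qᵢ) ≤ acc(pᵢ, qᵢ)` for every block `i`** (normalised block laws): a product flow
never accepts more often than its worst block. [ours] -/
theorem accRate_blockProd_le {pb qb : Fin m → Z → ℝ} (hp1 : ∀ i, ∑ z, pb i z = 1)
    (hq1 : ∀ i, ∑ z, qb i z = 1) (i : Fin m) :
    accRate (blockProd pb) (blockProd qb) ≤ accRate (pb i) (qb i) := by
  induction m with
  | zero => exact i.elim0
  | succ m ih =>
    rw [accRate_blockProd_succ]
    refine Fin.cases ?_ (fun j => ?_) i
    · exact accRate_prodLaw_le_left _ _ (sum_blockProd_eq_one fun i => hp1 i.succ)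
        (sum_blockProd_eq_one fun i => hq1 i.succ)
    · exact (accRate_prodLaw_le_right (hp1 0) (hq1 0) _ _).trans
        (ih (fun i => hp1 i.succ) (fun i => hq1 i.succ) j)

/-- **Identical blocks, lower**: `acc(p₀, q₀)^m ≤ acc(p₀^{⊗m}, q₀^{⊗m})`. [ours] -/
theorem pow_accRate_le_accRate_blockProd_const {p₀ q₀ : Z → ℝ} (hp : ∀ z, 0 ≤ p₀ z)
    (hq : ∀ z, 0 ≤ q₀ z) (m : ℕ) :
    accRate p₀ q₀ ^ m
      ≤ accRate (blockProd fun _ : Fin m => p₀) (blockProd fun _ : Fin m => q₀) := by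
  have h := prod_accRate_le_accRate_blockProd (pb := fun _ : Fin m => p₀) (qb := fun _ => q₀)
    (fun _ z => hp z) (fun _ z => hq z)
  rwa [Fin.prod_const] at h

/-- **Identical blocks, upper**: `acc(p₀^{⊗m}, q₀^{⊗m}) ≤ acc(p₀, q₀)` for `m ≥ 1`. [ours] -/
theorem accRate_blockProd_const_le {p₀ q₀ : Z → ℝ} (hp1 : ∑ z, p₀ z = 1) (hq1 : ∑ z, q₀ z = 1)
    (hm : 1 ≤ m) :
    accRate (blockProd fun _ : Fin m => p₀) (blockProd fun _ : Fin m => q₀) ≤ accRate p₀ q₀ :=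
  accRate_blockProd_le (pb := fun _ : Fin m => p₀) (qb := fun _ => q₀) (fun _ => hp1) (fun _ => hq1)
    ⟨0, hm⟩

/-- **The two-sided exponential volume law**: for nonnegative block laws,
`∏ᵢ acc(pᵢ, qᵢ) ≤ acc(⊗pᵢ, ⊗qᵢ) ≤ ∏ᵢ BC(pᵢ, qᵢ)²` — per block the acceptance of a product flow
decays at a rate between `log(1/accᵢ)` and `log(1/BCᵢ²)` (the upper half is row 31's T2-M with
`bhatt_blockProd`). [ours] -/
theorem accRate_blockProd_sandwich {pb qb : Fin m → Z → ℝ} (hp : ∀ i z, 0 ≤ pb i z)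
    (hq : ∀ i z, 0 ≤ qb i z) :
    ∏ i, accRate (pb i) (qb i) ≤ accRate (blockProd pb) (blockProd qb) ∧
    accRate (blockProd pb) (blockProd qb) ≤ ∏ i, bhatt (pb i) (qb i) ^ 2 := by
  refine ⟨prod_accRate_le_accRate_blockProd hp hq, ?_⟩
  have hP : ∀ φ, 0 ≤ blockProd pb φ := fun φ => prod_nonneg fun i _ => hp i _
  have hQ : ∀ φ, 0 ≤ blockProd qb φ := fun φ => prod_nonneg fun i _ => hq i _
  calc accRate (blockProd pb) (blockProd qb)
      ≤ bhatt (blockProd pb) (blockProd qb) ^ 2 := accRate_le_bhatt_sq hP hQ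
    _ = ∏ i, bhatt (pb i) (qb i) ^ 2 := by rw [bhatt_blockProd hp hq, prod_pow]

end Blocks

/-! ## §3 The lower rate is attained: hit-or-miss blocks -/

section HitOrMiss

variable {m : ℕ}

/-- The two-point HIT-OR-MISS block: target `δ_hit = ![0, 1]`, model `![1 − α, α]` hitting it with
probability `α ≤ 1`; its acceptance is `α`. [ours] -/
theorem hitOrMiss_accRate {α : ℝ} (hα1 : α ≤ 1) :
    accRate ![(0 : ℝ), 1] ![1 - α, α] = α := by
  have h1α : 0 ≤ 1 - α := by linarith
  unfold accRate
  simp only [Fin.sum_univ_two, Matrix.cons_val_zero, Matrix.cons_val_one, zero_mul, one_mul,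
    min_self, min_eq_left h1α, min_eq_right h1α]
  ring

/-- … and its squared Bhattacharyya coefficient is ALSO `α`: `BC = √0·√(1−α) + √1·√α`. [ours] -/
theorem hitOrMiss_bhatt_sq {α : ℝ} (hα0 : 0 ≤ α) :
    bhatt ![(0 : ℝ), 1] ![1 - α, α] ^ 2 = α := by
  unfold bhatt
  simp only [Fin.sum_univ_two, Matrix.cons_val_zero, Matrix.cons_val_one, zero_mul, one_mul,
    Real.sqrt_zero, zero_add]
  exact Real.sq_sqrt hα0

/-- **The product of the block acceptances is ATTAINED**: for hit-or-miss blocks with hitting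
probabilities `αᵢ ∈ [0, 1]` the sandwich `∏ accᵢ ≤ acc(⊗) ≤ ∏ BCᵢ²` collapses, and
`acc(⊗ᵢ δ_hit, ⊗ᵢ ![1 − αᵢ, αᵢ]) = ∏ᵢ αᵢ` exactly, at every number of blocks `m`. [ours] -/
theorem accRate_blockProd_hitOrMiss (α : Fin m → ℝ) (hα0 : ∀ i, 0 ≤ α i) (hα1 : ∀ i, α i ≤ 1) :
    accRate (blockProd fun _ : Fin m => ![(0 : ℝ), 1]) (blockProd fun i => ![1 - α i, α i])
      = ∏ i, α i := by
  have hp : ∀ (_i : Fin m) (z : Fin 2), 0 ≤ (![(0 : ℝ), 1] : Fin 2 → ℝ) z := by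
    intro i z; fin_cases z <;> simp
  have hq : ∀ (i : Fin m) (z : Fin 2), 0 ≤ (![1 - α i, α i] : Fin 2 → ℝ) z := by
    intro i z; fin_cases z <;> simp [hα0 i, hα1 i]
  obtain ⟨hlo, hhi⟩ := accRate_blockProd_sandwich (pb := fun _ : Fin m => ![(0 : ℝ), 1])
    (qb := fun i => ![1 - α i, α i]) hp hq
  simp only [hitOrMiss_accRate (hα1 _), hitOrMiss_bhatt_sq (hα0 _)] at hlo hhi
  exact le_antisymm hhi hlo

/-- **Identical hit-or-miss blocks**: `acc = α^m` — the acceptance of the exact chain decays at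
EXACTLY the rate `log(1/α)` per block, matching both the lower law `acc₁^m` and the upper law
`BC₁^{2m}`. [ours] -/
theorem accRate_blockProd_hitOrMiss_const {α : ℝ} (hα0 : 0 ≤ α) (hα1 : α ≤ 1) (m : ℕ) :
    accRate (blockProd fun _ : Fin m => ![(0 : ℝ), 1]) (blockProd fun _ : Fin m => ![1 - α, α])
      = α ^ m := by
  rw [accRate_blockProd_hitOrMiss (fun _ : Fin m => α) (fun _ => hα0) (fun _ => hα1), Fin.prod_const]

end HitOrMiss

end Summit.Ventures.LatticeQCDFlow.Theory2
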